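import Summits.HodgeConjecture.HodgeConjecture.Theorems.Ring2ClassTargetsRowsSixSevenWeilPullbacks
import Summits.HodgeConjecture.HodgeConjecture.Theorems.Ring2HypothesesGeneralHodge
import Literature.AlgebraicGeometry.HodgeTheory.CMHodgeOfRankFourWeilClasses
import HarnessLib

/-!
# Ring 2 around `HC_CM` — part XXII: the hypothesis priced IN CODIMENSION TWO (Hazama 2003 with André 1992 at `k = 2`) (typer 2)

HONEST FRAMING (page 1, verbatim in every file of this cell): research route conditional on HC_CM; not a
corollary; Q11.4-sentence-2 already refuted in dim ≥ 3.

`HC_CM` := `Theses.RankFourFaces.CMAbelianHodge` (item stmt-HodgeConjecture-3052, the Hodge conjecture for complex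
abelian varieties of CM type) is OPEN and occurs below only as a HYPOTHESIS `(hCM : …)` BY NAME or as the
CONCLUSION of an implication whose open inputs are explicit binders; it is never a cited fact and has no summit-side
copy. The two printed theorems used are the tree's NAMED FACTS, taken as hypotheses by name (never asserted):
`Hazama2003_generalHodge_cmType_of_hodge_codimTwo` (`h83`) and
`Andre1992_hodgeClasses_cmAbelianVariety_mem_span_pullback_weilClasses` (`h𝔄`), both REFEREED; the floor input
`Markman2025_weilClasses_algebraic_abelianFourfold` (`hF`, F1: Weil classes on Weil-type abelian FOURFOLDS) is a
CLAIM-tagged record (arXiv:2502.03415 Cor. 1.6.1, UNREFEREED in general; refereed for discriminant `1`). No `sorry`,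
no definition, no new named fact.

THE SOURCES (verbatim, as quoted first-hand in the two Literature records this file composes).
* F. Hazama, Publ. RIMS 39 (2003) 625–655 [Hazama2003GHCCM], Abstract p. 625: "The General Hodge Conjecture for
  abelian varieties of CM-type is shown to be implied by the usual Hodge Conjecture for those up to codimension
  two."; Thm. 8.3 p. 655: "Suppose that any Hodge cycle of codimension two on `A_{A(2ⁿ)}(G; K)` is algebraic for
  any pair `(G, K)`. Then the whole GHC holds for any abelian variety of CM-type." Restated by J. S. Milne, *The
  Tate conjecture over finite fields (AIM talk)*, arXiv:0709.3040 [Milne2007TateFiniteFieldsAIM], Thm. 8.5: "In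
  order to prove the Hodge conjecture for CM abelian varieties over `ℂ`, it suffices to prove it in codimension 2."
* Y. André 1992 = F. Charles, C. Schnell, *Notes on absolute Hodge classes* (2014) [CharlesSchnell2014Notes],
  Thm. 11.5.21 p. 510: every Hodge cycle `ξ ∈ ⋀^{2k}_ℚ V` of a CM Hodge structure `V` of type `{(1,0),(0,1)}` "is a
  sum of images of Hodge cycles `ξ_α ∈ ⋀^{2k}_ℚ V_α` of split Weil type", `dim_E V_α = 2k`.
* Their composition at `k = 2` is the Literature theorem `cmHodgeHypothesisAt_of_rankFourWeil`
  (`HodgeTheory/CMHodgeOfRankFourWeilClasses`, cell `pub-hodgecm`): (H) = `HC_CM` follows from the algebraicity of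
  the WEIL CLASSES OF `E`-RANK FOUR — (a) rational `(2,2)` Weil classes on abelian FOURFOLDS with `ψ² = -d`
  (`E = ℚ(√-d)`), (b) rational `(2,2)` classes of `weilClassesField B ψ P 4` for a CM field `E = ℚ(ψ)` of degree
  `e > 2` acting on `B` of dimension `2e ≥ 8`.

WHAT THIS FILE ADDS (the cell's side: the same composition on the cell's TYPED predicates and items, so that the
re-pricing is visible on the atlas / census / ladder axes of RING2-MAP).
§C1 `HC_CM` BY NAME ⟹ its codimension-two case at every `B` (unconditional) and ⟸ it granted `h83`
  (`hc_cm_of_hazama_of_forall_cmHodgeCodimTwo`); the atlas CM column `HCOnClass IsOfCMType` ⟺ the codimension-two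
  case granted `h83`. COUNT ONCE (LEAD L12.3 (ii)): the packaged `Iff` on the binder is the deformation axis'
  `Ring2.Deform.HC_CM_iff_forall_codimTwo_of_hazama2003` (`Theorems/Ring2DeformFrameRows.lean` §D, landed first) —
  refer to THAT name; the identical `HC_CM_iff_forall_cmHodgeCodimTwo_of_hazama` below is kept append-only as a
  DEPRECATED alias and is not used in this file.
§C2 (a) IS F1's statement up to its provable smooth-projective guard, and (a) also follows from the dimension row
  `HCAtDim 4`; (b) IS typer 1's price `CodimTwoWeilClassesCMFieldOff (fun _ ↦ False)` (the `2m = 4` slice of the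
  ladder rung R3 = `WeilTypeLadder.WeilClassesCMField`, demanded on every `B`). Hence
  `hc_cm_of_andre_of_hazama_of_weilClassesFourfolds_of_codimTwoCMField : h𝔄 → h83 → F1 → R3⁽²⁾ → HC_CM` and the
  variant with `HCAtDim 4` / `HCUpToDim 5` for F1. COMPARE the ladder's `rankFourFaces_cmAbelianHodge_of_andre_of_rungs :
  h𝔄 → R∞ → R3 → HC_CM` (R∞ = Weil classes for imaginary quadratic `K` in EVERY half-dimension `n ≥ 2`, R3 in EVERY
  `m`): one more refereed record (Hazama) cuts both rungs down to `E`-rank `4` (`n = m = 2`).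
§C3 SANDWICH and EXACTNESS. `HC_CM` gives (b) back on the CM members only (`codimTwoWeilClassesCMFieldOff_nonCM_of_hc_cm`,
  unconditional); so, granted `h𝔄`, `h83`, F1: `HC_CM ∧ (b off CM) ⟺ (b)` — modulo the two records and the Weil
  fourfolds, the pair {`HC_CM`, `E`-rank-4 CM-field Weil classes on NON-CM `B`} is EXACTLY the `E`-rank-4 CM-field Weil
  classes. (In print André's targets `B_α` are themselves CM and the classes split; the tree's record dropped both —
  the safe direction — so the kernel cannot sharpen the right-hand side to "on CM `B`"; nothing beyond the record is
  claimed.) HABITAT READING: the codimension-two content of `HC_CM` lives on the Weil fourfolds (F1) and on the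
  `E`-rank-4 rows `(K, 4, δ)`, `[K:ℚ] = e ≥ 4` even, `dim = 2e ≥ 8`, of the Weil-type component axis — OUTSIDE the
  atlas rows `g ≤ 7` except through F1.
§C4 CONSEQUENCES WITH NO `HC_CM` BINDER (each previously stated under `(hCM : HC_CM)`): typer 1's §W3 census
  `HCUpToDim 7` from {X2′, X1, `W₆` off CM; floor} now needs, instead of `HC_CM`, the records `h𝔄`, `h83` and (b) on
  ALL `B` (it already needed (b) off CM); every atlas cell reduces to its non-CM part; item stmt-16267
  (`CMToAbelian`) becomes `HC_AV` itself; `GHC_CM`; Tate's (0.1) over finite fields (Milne 1999 Thm. 7.1, by name);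
  and, granted the four transport leaves of `Ring2Transport`, the WHOLE Weil-type ladder R∞ ∧ R3 follows from its
  `E`-rank-4 rungs (`weilRungs_of_rankFour_of_andre_of_hazama_of_transport`).
§C5 AUDIT: every HC-shaped input or output here follows from `HodgeConjecture` (on-path); nothing is progress on
  the summit; `h𝔄`, `h83` are structure theorems about CM Hodge rings, not consequences of HC, and are never asserted.

References (bib keys): Hazama2003GHCCM (Abstract p. 625, §1, Thm. 8.3 p. 655), Hazama2002GHCCM (Thm. 7.6 p. 75),
Milne2007TateFiniteFieldsAIM (Thm. 8.5, §8.3, §10), Andre1992HodgeCM (Théorème), CharlesSchnell2014Notes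
(Thm. 11.5.21 p. 510), Deligne1982HodgeCycles (endnote M.12, §5), Markman2025SecantWeil (Cor. 1.6.1, UNREFEREED),
Markman2025SurveySecant (Thm. 1.4, §12), MoonenZarhin1998WeilClasses (§1), MoonenZarhin1999LowDim (§5),
Milne1999 (§2, Thm. 7.1 p. 72), GrothendieckTopology1969 (p. 301), Deligne2000 (§1).
-/

set_option linter.dupNamespace false

noncomputable section

open CategoryTheory Literature.AlgebraicGeometry Literature.AlgebraicGeometry.Motives
open Literature.AlgebraicGeometry.HodgeTheory Literature.AlgebraicGeometry.Milne1999
open Literature.AlgebraicTopology.SingularHomology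

namespace Summit.HodgeConjecture.HodgeConjecture.Ring2.Hypotheses

open Summit.HodgeConjecture.HodgeConjecture.Ring2.ClassTargets

/-! ## §C1 `HC_CM` by name and its codimension-two case (Hazama 2003) -/

/-- `HC_CM` (binder by name) gives its codimension-two case at every `B`, unconditionally.
[cite: Hazama2003GHCCM, §1 p. 625] [cite: Milne1999, §7 (H)] -/
theorem cmHodgeCodimTwo_of_hc_cm (hCM : Theses.RankFourFaces.CMAbelianHodge) (B : AbelianVariety ℂ) :
    CMHodgeCodimTwoHypothesisAt B :=
  (cmAbelianHodge_iff_forall_cmHodgeHypothesisAt.mp hCM B).codimTwo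

/-- **Granted Hazama's theorem, the codimension-two case gives `HC_CM` (the route item, by name).** `HC_CM` is the
CONCLUSION; its inputs are the record `h83` and the open codimension-two hypothesis `h2`, both binders.
[cite: Hazama2003GHCCM, Abstract p. 625 and Thm. 8.3 p. 655] [cite: GrothendieckTopology1969, p. 301] -/
theorem hc_cm_of_hazama_of_forall_cmHodgeCodimTwo (h83 : Hazama2003_generalHodge_cmType_of_hodge_codimTwo)
    (h2 : ∀ B : AbelianVariety ℂ, CMHodgeCodimTwoHypothesisAt B) : Theses.RankFourFaces.CMAbelianHodge :=
  cmAbelianHodge_iff_forall_cmHodgeHypothesisAt.mpr fun A ↦ cmHodgeHypothesisAt_of_codimTwo h83 h2 A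

/-- DEPRECATED ALIAS (count once, LEAD L12.3 (ii)): this `Iff` is, verbatim, the deformation axis'
`Ring2.Deform.HC_CM_iff_forall_codimTwo_of_hazama2003` (`Theorems/Ring2DeformFrameRows.lean` §D), which landed
first — refer to that name. Kept here only because tree files are append-only; nothing in this file uses it.
(`HC_CM ⟺ HC_CM in codimension two`, granted Hazama's theorem; Milne, AIM talk Thm. 8.5: "it suffices to prove it
in codimension 2". Neither side is asserted.) [cite: Hazama2003GHCCM, Thm. 8.3 p. 655]
[cite: Milne2007TateFiniteFieldsAIM, Thm. 8.5] -/
@[deprecated "count once — use Ring2.Deform.HC_CM_iff_forall_codimTwo_of_hazama2003 (Ring2DeformFrameRows §D)"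
  (since := "2026-08-19")]
theorem HC_CM_iff_forall_cmHodgeCodimTwo_of_hazama (h83 : Hazama2003_generalHodge_cmType_of_hodge_codimTwo) :
    Theses.RankFourFaces.CMAbelianHodge ↔ ∀ B : AbelianVariety ℂ, CMHodgeCodimTwoHypothesisAt B :=
  cmAbelianHodge_iff_forall_cmHodgeHypothesisAt.trans (cmHodgeHypothesis_iff_codimTwo h83)

/-- The atlas's CM COLUMN (`HCOnClass IsOfCMType`, every dimension, every codimension) is, granted Hazama's theorem,
its codimension-two part (Milne, AIM talk Thm. 8.5: "it suffices to prove it in codimension 2"). The same `Iff` on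
the binder `HC_CM` itself is the deformation axis' `Ring2.Deform.HC_CM_iff_forall_codimTwo_of_hazama2003`, cited by
name. Neither side is asserted. [cite: Hazama2003GHCCM, Thm. 8.3 p. 655] [cite: Milne2007TateFiniteFieldsAIM, Thm. 8.5]
[cite: Milne1999, §2 p. 54] -/
theorem hcOnClass_cmType_iff_forall_cmHodgeCodimTwo_of_hazama
    (h83 : Hazama2003_generalHodge_cmType_of_hodge_codimTwo) :
    HCOnClass IsOfCMType ↔ ∀ B : AbelianVariety ℂ, CMHodgeCodimTwoHypothesisAt B :=
  ⟨fun h ↦ cmHodgeCodimTwo_of_hc_cm (hcOnClass_cmType_iff_cmAbelianHodge.mp h),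
    fun h2 ↦ hcOnClass_cmType_iff_cmAbelianHodge.mpr (hc_cm_of_hazama_of_forall_cmHodgeCodimTwo h83 h2)⟩

/-! ## §C2 The cell's typed price of the codimension-two case (André 1992 at `k = 2`) -/

/-- The smooth-projective guard of an abelian variety of dimension `2·2`, in F1's spelling. [folklore] -/
theorem isSmoothProjective_two_mul_two_of_dim {B : AbelianVariety ℂ} (hB : B.dim = 2 * 2) :
    IsSmoothProjective (2 * 2) B.X := by
  have h : IsSmoothProjective B.dim B.X := AbelianVariety.isSmoothProjective_holds
  rwa [hB] at h

/-- **The codimension-two case of `HC_CM` from André's record, the Weil FOURFOLDS (F1) and the codimension-2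
CM-field Weil classes (typer 1's `CodimTwoWeilClassesCMFieldOff`, demanded on every `B`).** Hypothesis (a) of the
Literature composition is F1 with its guard discharged; (b) is the price at the empty class.
[cite: CharlesSchnell2014Notes, Thm. 11.5.21 (p. 510)] [cite: Andre1992HodgeCM, Théorème] [cite: Markman2025SecantWeil, Cor. 1.6.1] -/
theorem forall_cmHodgeCodimTwo_of_andre_of_weilClassesFourfolds_of_codimTwoCMField
    (h𝔄 : Andre1992_hodgeClasses_cmAbelianVariety_mem_span_pullback_weilClasses)
    (hF : Markman2025_weilClasses_algebraic_abelianFourfold)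
    (h₆ : CodimTwoWeilClassesCMFieldOff fun _ ↦ False) (B : AbelianVariety ℂ) :
    CMHodgeCodimTwoHypothesisAt B :=
  cmHodgeCodimTwoHypothesisAt_of_andre1992_of_rankFourWeil h𝔄
    (fun d hd B' ψ hB' hψ w hw hwt hweil ↦
      hF d hd B' ψ hB' (isSmoothProjective_two_mul_two_of_dim hB') hψ w hw hwt hweil)
    (fun B' ψ P e hP hPe he hirr hev hdim hreal hQ w hweil hw hwt ↦
      h₆ B' ψ P e hP hPe he hirr hev hdim hreal hQ (fun h ↦ h) w hweil hw hwt) B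

/-- Same with F1 replaced by the atlas ROW `g = 4` (`HCAtDim 4`): a rational `(2,2)` Weil class on a fourfold is
in particular a rational `(2,2)` class. [cite: Andre1992HodgeCM, Théorème] [cite: MoonenZarhin1999LowDim, Thm. 0.1] -/
theorem forall_cmHodgeCodimTwo_of_andre_of_hcAtDim_four_of_codimTwoCMField
    (h𝔄 : Andre1992_hodgeClasses_cmAbelianVariety_mem_span_pullback_weilClasses) (h4 : HCAtDim 4)
    (h₆ : CodimTwoWeilClassesCMFieldOff fun _ ↦ False) (B : AbelianVariety ℂ) :
    CMHodgeCodimTwoHypothesisAt B :=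
  cmHodgeCodimTwoHypothesisAt_of_andre1992_of_rankFourWeil h𝔄
    (fun d _ B' ψ hB' _ w hw hwt _ ↦ (h4 B' (by omega)).2 2 w hw (by rw [hB']; exact hwt))
    (fun B' ψ P e hP hPe he hirr hev hdim hreal hQ w hweil hw hwt ↦
      h₆ B' ψ P e hP hPe he hirr hev hdim hreal hQ (fun h ↦ h) w hweil hw hwt) B

/-! ## §C3 The headline, the sandwich and the exactness -/

/-- **HEADLINE — `[André 1992] → [Hazama 2003] → F1 → R3⁽²⁾ → HC_CM`.** Granted the two refereed records, the Weil
classes on Weil-type abelian FOURFOLDS (F1; every imaginary quadratic `K`, every discriminant) and the codimension-2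
Weil classes of CM-FIELD Weil type (`E`-rank `4`, `dim B = 2[E:ℚ] ≥ 8`; OPEN for every such `E`) PROVE the route
item `HC_CM`. Compare `WeilTypeLadder.rankFourFaces_cmAbelianHodge_of_andre_of_rungs` (R∞ in every `n`, R3 in
every `m`): Hazama's theorem cuts both rungs down to `n = m = 2`. `HC_CM` is the conclusion, not an input.
[cite: Hazama2003GHCCM, Thm. 8.3 p. 655] [cite: Milne2007TateFiniteFieldsAIM, Thm. 8.5 and §10]
[cite: CharlesSchnell2014Notes, Thm. 11.5.21 (p. 510)] [cite: Markman2025SecantWeil, Cor. 1.6.1] -/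
theorem hc_cm_of_andre_of_hazama_of_weilClassesFourfolds_of_codimTwoCMField
    (h𝔄 : Andre1992_hodgeClasses_cmAbelianVariety_mem_span_pullback_weilClasses)
    (h83 : Hazama2003_generalHodge_cmType_of_hodge_codimTwo)
    (hF : Markman2025_weilClasses_algebraic_abelianFourfold) (h₆ : CodimTwoWeilClassesCMFieldOff fun _ ↦ False) :
    Theses.RankFourFaces.CMAbelianHodge :=
  hc_cm_of_hazama_of_forall_cmHodgeCodimTwo h83
    (forall_cmHodgeCodimTwo_of_andre_of_weilClassesFourfolds_of_codimTwoCMField h𝔄 hF h₆)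

/-- The headline with the atlas row `g = 4` in place of F1. [cite: Hazama2003GHCCM, Thm. 8.3 p. 655]
[cite: Andre1992HodgeCM, Théorème] [cite: MoonenZarhin1999LowDim, Thm. 0.1] -/
theorem hc_cm_of_andre_of_hazama_of_hcAtDim_four_of_codimTwoCMField
    (h𝔄 : Andre1992_hodgeClasses_cmAbelianVariety_mem_span_pullback_weilClasses)
    (h83 : Hazama2003_generalHodge_cmType_of_hodge_codimTwo) (h4 : HCAtDim 4)
    (h₆ : CodimTwoWeilClassesCMFieldOff fun _ ↦ False) : Theses.RankFourFaces.CMAbelianHodge :=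
  hc_cm_of_hazama_of_forall_cmHodgeCodimTwo h83
    (forall_cmHodgeCodimTwo_of_andre_of_hcAtDim_four_of_codimTwoCMField h𝔄 h4 h₆)

/-- The headline with the census FLOOR `HCUpToDim 5` in place of F1 (the floor contains row `4`).
[cite: Hazama2003GHCCM, Thm. 8.3 p. 655] [cite: MoonenZarhin1999LowDim, Thms. 0.1, 0.2] -/
theorem hc_cm_of_andre_of_hazama_of_hcUpToDim_five_of_codimTwoCMField
    (h𝔄 : Andre1992_hodgeClasses_cmAbelianVariety_mem_span_pullback_weilClasses)
    (h83 : Hazama2003_generalHodge_cmType_of_hodge_codimTwo) (h₅ : HCUpToDim 5)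
    (h₆ : CodimTwoWeilClassesCMFieldOff fun _ ↦ False) : Theses.RankFourFaces.CMAbelianHodge :=
  hc_cm_of_andre_of_hazama_of_hcAtDim_four_of_codimTwoCMField h𝔄 h83
    (hcAtDim_of_hcUpToDim (hcUpToDim_mono (by norm_num) h₅)) h₆

/-- The price is antitone in the excluded class: demanded off a smaller class it is demanded on more `B`.
[folklore] -/
theorem codimTwoWeilClassesCMFieldOff_mono {𝒞 𝒟 : AbelianVariety ℂ → Prop} (h𝒞𝒟 : ∀ B, 𝒞 B → 𝒟 B)
    (h : CodimTwoWeilClassesCMFieldOff 𝒞) : CodimTwoWeilClassesCMFieldOff 𝒟 :=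
  fun B ψ P e hP hPe he hirr hev hdim hreal hQ hB w hweil hw hwt ↦
    h B ψ P e hP hPe he hirr hev hdim hreal hQ (fun hB' ↦ hB (h𝒞𝒟 B hB')) w hweil hw hwt

/-- The price on the members of `𝒞` together with the price off `𝒞` is the price on every `B`. [folklore] -/
theorem codimTwoWeilClassesCMFieldOff_bot_of_on_of_off {𝒞 : AbelianVariety ℂ → Prop}
    (hon : CodimTwoWeilClassesCMFieldOff fun B ↦ ¬ 𝒞 B) (hoff : CodimTwoWeilClassesCMFieldOff 𝒞) :
    CodimTwoWeilClassesCMFieldOff fun _ ↦ False := by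
  intro B ψ P e hP hPe he hirr hev hdim hreal hQ _ w hweil hw hwt
  by_cases hB : 𝒞 B
  · exact hon B ψ P e hP hPe he hirr hev hdim hreal hQ (fun h ↦ h hB) w hweil hw hwt
  · exact hoff B ψ P e hP hPe he hirr hev hdim hreal hQ hB w hweil hw hwt

/-- **Upper half of the sandwich, unconditional: `HC_CM` gives the codimension-2 CM-field Weil classes on the CM
members** (a Weil class is a rational `(2,2)` class; `HC_CM` by name through `hcOnClass_cmType_of_hcCM`). On the
NON-CM members `HC_CM` says nothing. [cite: Milne1999, §7 (H)] [cite: MoonenZarhin1998WeilClasses, §1] -/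
theorem codimTwoWeilClassesCMFieldOff_nonCM_of_hc_cm (hCM : Theses.RankFourFaces.CMAbelianHodge) :
    CodimTwoWeilClassesCMFieldOff fun B ↦ ¬ IsOfCMType B :=
  fun B _ _ _ _ _ _ _ _ _ _ _ hB w _ hwQ hwt ↦ (hcOnClass_cmType_of_hcCM hCM B (not_not.mp hB)).2 2 w hwQ hwt

/-- **EXACTNESS — granted André, Hazama and the Weil fourfolds: `HC_CM ∧ R3⁽²⁾ off CM ⟺ R3⁽²⁾`.** Modulo the two
refereed records and F1, the pair {`HC_CM`, codimension-2 CM-field Weil classes on NON-CM abelian varieties} is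
EXACTLY the codimension-2 CM-field Weil classes (`E`-rank `4`, every CM field `E` of degree `> 2`). `→` is
unconditional. [cite: Hazama2003GHCCM, Thm. 8.3 p. 655] [cite: CharlesSchnell2014Notes, Thm. 11.5.21 (p. 510)]
[cite: MoonenZarhin1998WeilClasses, §1] -/
theorem hc_cm_and_codimTwoCMFieldOffCM_iff_of_andre_of_hazama_of_weilClassesFourfolds
    (h𝔄 : Andre1992_hodgeClasses_cmAbelianVariety_mem_span_pullback_weilClasses)
    (h83 : Hazama2003_generalHodge_cmType_of_hodge_codimTwo)
    (hF : Markman2025_weilClasses_algebraic_abelianFourfold) :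
    Theses.RankFourFaces.CMAbelianHodge ∧ CodimTwoWeilClassesCMFieldOff IsOfCMType ↔
      CodimTwoWeilClassesCMFieldOff fun _ ↦ False :=
  ⟨fun h ↦ codimTwoWeilClassesCMFieldOff_bot_of_on_of_off (codimTwoWeilClassesCMFieldOff_nonCM_of_hc_cm h.1) h.2,
    fun h₆ ↦ ⟨hc_cm_of_andre_of_hazama_of_weilClassesFourfolds_of_codimTwoCMField h𝔄 h83 hF h₆,
      codimTwoWeilClassesCMFieldOff_mono (fun _ h ↦ h.elim) h₆⟩⟩

/-! ## §C4 Consequences with NO `HC_CM` binder -/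

/-- **`GHC_CM` (Grothendieck's amended general Hodge conjecture on the CM locus, the cell's `GeneralHodgeCMAbelian`)
from André, Hazama, F1 and R3⁽²⁾** — Hazama's actual conclusion. [cite: Hazama2003GHCCM, Thm. 8.3 p. 655]
[cite: GrothendieckTopology1969, pp. 300–301] [cite: CharlesSchnell2014Notes, Thm. 11.5.21 (p. 510)] -/
theorem generalHodgeCMAbelian_of_andre_of_hazama_of_weilClassesFourfolds_of_codimTwoCMField
    (h𝔄 : Andre1992_hodgeClasses_cmAbelianVariety_mem_span_pullback_weilClasses)
    (h83 : Hazama2003_generalHodge_cmType_of_hodge_codimTwo)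
    (hF : Markman2025_weilClasses_algebraic_abelianFourfold) (h₆ : CodimTwoWeilClassesCMFieldOff fun _ ↦ False) :
    GeneralHodgeCMAbelian :=
  fun A ↦ cmGeneralHodgeHypothesisAt_of_codimTwo h83
    (forall_cmHodgeCodimTwo_of_andre_of_weilClassesFourfolds_of_codimTwoCMField h𝔄 hF h₆) A

/-- **The re-targeted census WITHOUT the `HC_CM` binder** (compare typer 1's
`hcUpToDim_seven_of_hcCM_of_censusOffCM_weilPullbacks`, which takes `(hCM : HC_CM)` and the price OFF CM): rows
`≤ 7` from X2′ off CM, X1 off CM, the NON-CM Weil sixfolds, the codimension-2 CM-field Weil classes on EVERY `B`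
(dimension `2e ≥ 8`), the floor, André and Hazama — `HC_CM` being derived from the last four (row `4` of the floor
standing in for F1). [cite: Hazama2003GHCCM, Thm. 8.3 p. 655] [cite: Andre1992HodgeCM, Théorème]
[cite: MoonenZarhin1999LowDim, §5; arXiv:math/9901113] -/
theorem hcUpToDim_seven_of_andre_of_hazama_of_censusOffCM_weilPullbacks
    (h𝔄 : Andre1992_hodgeClasses_cmAbelianVariety_mem_span_pullback_weilClasses)
    (h83 : Hazama2003_generalHodge_cmType_of_hodge_codimTwo)
    (h₃ : CodimTwoFromWeilPullbacksOff IsOfCMType) (h₂ : CodimThreeWeilGenerationOff IsOfCMType)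
    (h₄ : WeilSixfoldsOff IsOfCMType) (h₆ : CodimTwoWeilClassesCMFieldOff fun _ ↦ False) (h₅ : HCUpToDim 5) :
    HCUpToDim 7 :=
  hcUpToDim_seven_of_hcCM_of_censusOffCM_weilPullbacks
    (hc_cm_of_andre_of_hazama_of_hcUpToDim_five_of_codimTwoCMField h𝔄 h83 h₅ h₆) h₃ h₂ h₄
    (codimTwoWeilClassesCMFieldOff_mono (fun _ h ↦ h.elim) h₆) h₅

/-- Its exactness form, no `HC_CM` binder: modulo {André, Hazama, X2′ off CM, X1 off CM, R3⁽²⁾, floor}, rows `≤ 7`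
are EXACTLY the Weil classes of the NON-CM Weil-type sixfolds. [cite: Markman2025SecantWeil, Thm. 1.5.1]
[cite: Hazama2003GHCCM, Thm. 8.3 p. 655] [cite: MoonenZarhin1999LowDim, §5] -/
theorem hcUpToDim_seven_iff_nonCMWeilSixfolds_of_andre_of_hazama_weilPullbacks
    (h𝔄 : Andre1992_hodgeClasses_cmAbelianVariety_mem_span_pullback_weilClasses)
    (h83 : Hazama2003_generalHodge_cmType_of_hodge_codimTwo)
    (h₃ : CodimTwoFromWeilPullbacksOff IsOfCMType) (h₂ : CodimThreeWeilGenerationOff IsOfCMType)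
    (h₆ : CodimTwoWeilClassesCMFieldOff fun _ ↦ False) (h₅ : HCUpToDim 5) :
    HCUpToDim 7 ↔ WeilSixfoldsOff IsOfCMType :=
  hcUpToDim_seven_iff_nonCMWeilSixfolds_of_hcCM_weilPullbacks
    (hc_cm_of_andre_of_hazama_of_hcUpToDim_five_of_codimTwoCMField h𝔄 h83 h₅ h₆) h₃ h₂
    (codimTwoWeilClassesCMFieldOff_mono (fun _ h ↦ h.elim) h₆) h₅

/-- **Every atlas cell reduces to its NON-CM part, with no `HC_CM` binder**: granted André, Hazama, F1 and R3⁽²⁾,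
`HCOnClass 𝒞` follows from HC on the non-CM members of `𝒞` (typer 1's `hcOnClass_iff_nonCM_of_hcCM` fed by the
headline). In particular the CM column `HCOnClass IsOfCMType` — every CM row of the atlas, e.g. the CM Weil-type
sixfolds — closes from these four inputs (take `𝒞 := IsOfCMType`; the non-CM part is empty).
[cite: Hazama2003GHCCM, Thm. 8.3 p. 655] [cite: Andre1992HodgeCM, Théorème] [cite: Milne1999, §2 p. 54] -/
theorem hcOnClass_of_nonCM_of_andre_of_hazama_of_weilClassesFourfolds_of_codimTwoCMField
    (h𝔄 : Andre1992_hodgeClasses_cmAbelianVariety_mem_span_pullback_weilClasses)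
    (h83 : Hazama2003_generalHodge_cmType_of_hodge_codimTwo)
    (hF : Markman2025_weilClasses_algebraic_abelianFourfold) (h₆ : CodimTwoWeilClassesCMFieldOff fun _ ↦ False)
    {𝒞 : AbelianVariety ℂ → Prop} (h : HCOnClass fun A ↦ 𝒞 A ∧ ¬ IsOfCMType A) : HCOnClass 𝒞 :=
  (hcOnClass_iff_nonCM_of_hcCM
    (hc_cm_of_andre_of_hazama_of_weilClassesFourfolds_of_codimTwoCMField h𝔄 h83 hF h₆) 𝒞).mpr h

/-- The CM column itself from the four inputs (the case `𝒞 := IsOfCMType`). [cite: Hazama2003GHCCM, Thm. 8.3 p. 655]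
[cite: Milne1999, §2 p. 54 and §7 (H)] -/
theorem hcOnClass_cmType_of_andre_of_hazama_of_weilClassesFourfolds_of_codimTwoCMField
    (h𝔄 : Andre1992_hodgeClasses_cmAbelianVariety_mem_span_pullback_weilClasses)
    (h83 : Hazama2003_generalHodge_cmType_of_hodge_codimTwo)
    (hF : Markman2025_weilClasses_algebraic_abelianFourfold) (h₆ : CodimTwoWeilClassesCMFieldOff fun _ ↦ False) :
    HCOnClass IsOfCMType :=
  hcOnClass_cmType_of_hcCM (hc_cm_of_andre_of_hazama_of_weilClassesFourfolds_of_codimTwoCMField h𝔄 h83 hF h₆)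

/-- **Item stmt-HodgeConjecture-16267 (`CMToAbelian` = `HC_CM → HC_AV`) IS `HC_AV`, granted André, Hazama, F1 and
R3⁽²⁾** (its hypothesis being then a theorem of the inputs). Neither side is asserted. [cite: Hazama2003GHCCM, Thm. 8.3 p. 655]
[cite: Deligne2000, §1] -/
theorem cmToAbelian_iff_hodgeAbelianVarieties_of_andre_of_hazama_of_weilClassesFourfolds_of_codimTwoCMField
    (h𝔄 : Andre1992_hodgeClasses_cmAbelianVariety_mem_span_pullback_weilClasses)
    (h83 : Hazama2003_generalHodge_cmType_of_hodge_codimTwo)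
    (hF : Markman2025_weilClasses_algebraic_abelianFourfold) (h₆ : CodimTwoWeilClassesCMFieldOff fun _ ↦ False) :
    Theses.RankFourFaces.CMToAbelian ↔ Theses.PadicSemiregularLift.HodgeAbelianVarieties :=
  ⟨fun h A ↦ h (hc_cm_of_andre_of_hazama_of_weilClassesFourfolds_of_codimTwoCMField h𝔄 h83 hF h₆) A
      AbelianVariety.isSmoothProjective_holds,
    fun h _ A _ ↦ h A⟩

/-- **The whole Weil-type ladder from its `E`-rank-4 rungs, granted André, Hazama and the four TRANSPORT leaves**
(`Ring2Transport.HC_CM_iff_weilRungs_of_andre_of_transport`: under the leaves `HC_CM ⟺ R∞ ∧ R3`): F1 (= R∞ at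
`n = 2`) and R3⁽²⁾ (= R3 at `m = 2`) give R∞ in every `n` and R3 in every `m`. Every input is a binder; the leaves
are open. [cite: Hazama2003GHCCM, Thm. 8.3 p. 655] [cite: CharlesSchnell2014Notes, Conj. 11.3.1 and Thm. 11.5.21]
[cite: Deligne1982HodgeCycles, §4 proof of Thm. 4.8 and §5] -/
theorem weilRungs_of_rankFour_of_andre_of_hazama_of_transport
    (h𝔄 : Andre1992_hodgeClasses_cmAbelianVariety_mem_span_pullback_weilClasses)
    (h83 : Hazama2003_generalHodge_cmType_of_hodge_codimTwo)
    (hF : Markman2025_weilClasses_algebraic_abelianFourfold) (h₆ : CodimTwoWeilClassesCMFieldOff fun _ ↦ False)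
    (hP₂ : Ring2Transport.CMPointedWeilFamiliesQuadratic) (hV₂ : WeilTypeLadder.WeilVariationalHodgeQuadratic)
    (hP₃ : Ring2Transport.CMPointedWeilFamiliesCMField) (hV₃ : WeilTypeLadder.WeilVariationalHodgeCMField) :
    WeilTypeLadder.WeilClassesImaginaryQuadratic ∧ WeilTypeLadder.WeilClassesCMField :=
  (Ring2Transport.HC_CM_iff_weilRungs_of_andre_of_transport h𝔄 hP₂ hV₂ hP₃ hV₃).mp
    (hc_cm_of_andre_of_hazama_of_weilClassesFourfolds_of_codimTwoCMField h𝔄 h83 hF h₆)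

/-- **Tate's (0.1) for every abelian variety over every finite field from André, Hazama, F1 and R3⁽²⁾**, through
Milne 1999 Thm. 7.1 at the intended ℓ-adic data `E` (by name; Milne, AIM talk §8.3: "in order to prove the Tate
conjecture for abelian varieties over `𝔽`, it suffices to prove the Hodge conjecture in codimension 2"). The cell-typed
form of the Literature theorem `Milne1999.tateAV_Fq_of_rankFourWeil`. [cite: Milne1999, Thm. 7.1 p. 72]
[cite: Milne2007TateFiniteFieldsAIM, §8.3 and Thm. 8.5] [cite: Hazama2003GHCCM, Thm. 8.3 p. 655] -/
theorem tateStatement01_of_andre_of_hazama_of_weilClassesFourfolds_of_codimTwoCMField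
    {E : ∀ (k : Type) [Field k] [Finite k] (ℓ : ℕ) [Fact ℓ.Prime] [NeZero (ℓ : k)],
      GaloisWeilCohomology k ℚ_[ℓ] (padicCyclotomicCharacter k ℓ)}
    (h71 : Theorem71 E) (h𝔄 : Andre1992_hodgeClasses_cmAbelianVariety_mem_span_pullback_weilClasses)
    (h83 : Hazama2003_generalHodge_cmType_of_hodge_codimTwo)
    (hF : Markman2025_weilClasses_algebraic_abelianFourfold) (h₆ : CodimTwoWeilClassesCMFieldOff fun _ ↦ False) :
    TateStatement01 E :=
  tateAV_Fq_of_HC_CM h71 (cmAbelianHodge_iff_forall_cmHodgeHypothesisAt.mp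
    (hc_cm_of_andre_of_hazama_of_weilClassesFourfolds_of_codimTwoCMField h𝔄 h83 hF h₆))

/-! ## §C5 Audit: every HC-shaped statement of this file is on-path -/

/-- Audit: the codimension-two hypothesis, F1, the price (every class) and `HC_CM` all follow from `HodgeConjecture`
(on-path; none is claimed as progress). André's and Hazama's records are structure theorems about CM Hodge rings, NOT
consequences of `HodgeConjecture`, and are never asserted. [cite: Deligne2000, §1] -/
theorem codimTwoInputs_of_hodgeConjecture (h : _root_.HodgeConjecture) (𝒞 : AbelianVariety ℂ → Prop) :
    (∀ B : AbelianVariety ℂ, CMHodgeCodimTwoHypothesisAt B) ∧ Markman2025_weilClasses_algebraic_abelianFourfold ∧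
      CodimTwoWeilClassesCMFieldOff 𝒞 ∧ Theses.RankFourFaces.CMAbelianHodge :=
  ⟨fun _ hB _ c hc hct ↦ (h hB).2 2 c hc hct,
    Markman2025_weilClasses_algebraic_abelianFourfold_of_hodgeConjectureFor (fun _ _ hX ↦ h hX),
    (rowsSixSevenWeilPullbacks_of_hodgeConjecture h 𝒞).2.2, Ring2.Deform.HC_CM_of_hodgeConjecture h⟩

end Summit.HodgeConjecture.HodgeConjecture.Ring2.Hypotheses

end
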